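import Mathlib
import Literature.Analysis.FunctionSpaces.PoissonPointProcess
import Literature.Probability.Percolation.CardyFormula
import Summits.CriticalPhenomena.CardyFormulaZ2.Theses.CardyFlipRusso
import Summits.CriticalPhenomena.CardyFormulaZ2.Theorems.CardyFlipRussoVoronoiHubFromSmirnovStubHypDensity
import Summits.CriticalPhenomena.CardyFormulaZ2.Theorems.CardyFlipRussoVoronoiHubFromSmirnovStubDelaunayMoebius
import Summits.CriticalPhenomena.CardyFormulaZ2.Theorems.CardyFlipRussoVoronoiHubFromSmirnovStubSpinSelection
import Summits.CriticalPhenomena.CardyFormulaZ2.Theorems.CardyFlipRussoVoronoiHubFromSmirnovStubCrossRatio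

/-!
# Skeleton — line `Sketch` for crux `VoronoiHubFromSmirnov` (stmt-CriticalPhenomena-6433)

Lead-owned skeleton (route CardyFlipRusso).  The line `Sketch` is the round-1 ideation sketch
(`Cruxes/VoronoiHubFromSmirnov/SketchIdeasR1K1.lean`): the first lemmas of the cards
annealed-morera-palm-defect (A), moebius-exact-delaunay-dilation-ward (B),
hyperbolic-intensity-exact-ci (C).  Stubs:

* `stub_spinSelection` (card A, provable now): a spin-`m ≠ 0` functional has zero mean under a
  rotation-invariant law;
* `stub_delaunayEdgeMoebius` (card B, provable now; RESHAPED: the sketch's statement is false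
  because of Lean's junk value `x / 0 = 0` at the pole — hypothesis `hX` (no point of `X` is the
  pole) added);
* `stub_hypDensityInvariant` (card C, provable now): Schwarz–Pick equality for disc automorphisms;
* `stub_crossRatioOfAutInvariant` (card C, provable now): an `Aut(𝔻)`-invariant functional of four
  circle points is a function of the cross-ratio of their Cayley preimages;
* `stub_annealedVoronoiCardy` — THE KERNEL: Cardy's formula for annealed Poisson–Voronoi percolation
  (= Target (i) of the route = the consequent of the crux; Benjamini–Schramm 1998, Conj. 10.1/1.1,
  OPEN).  Every card reduces the crux to this statement plus an unproved rate/kernel; none of the four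
  lemmas above enters the composition, which is `VoronoiHubFromSmirnov_of` below (the antecedent,
  Smirnov's theorem, is proved in tree and unused).
-/

open MeasureTheory Complex

namespace Summit.CriticalPhenomena.CardyFormulaZ2.Cruxes.VoronoiHubFromSmirnov.SketchLine

open Literature.Analysis.FunctionSpaces

-- stub_spinSelection: CLOSED — landed as
-- `Summit.CriticalPhenomena.CardyFormulaZ2.Cruxes.VoronoiHubFromSmirnov.SketchLine.stub_spinSelection`
-- (Theorems/CardyFlipRussoVoronoiHubFromSmirnovStubSpinSelection.lean, p103471), imported above.

-- stub_delaunayEdgeMoebius: CLOSED — landed as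
-- `Summit.CriticalPhenomena.CardyFormulaZ2.Cruxes.VoronoiHubFromSmirnov.SketchLine.stub_delaunayEdgeMoebius`
-- (Theorems/CardyFlipRussoVoronoiHubFromSmirnovStubDelaunayMoebius.lean, p102386), imported above.

-- stub_hypDensityInvariant: CLOSED — landed as
-- `Summit.CriticalPhenomena.CardyFormulaZ2.Cruxes.VoronoiHubFromSmirnov.SketchLine.stub_hypDensityInvariant`
-- (Theorems/CardyFlipRussoVoronoiHubFromSmirnovStubHypDensity.lean, p102869), imported above.

-- stub_crossRatioOfAutInvariant: CLOSED — landed as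
-- `Summit.CriticalPhenomena.CardyFormulaZ2.Cruxes.VoronoiHubFromSmirnov.SketchLine.stub_crossRatioOfAutInvariant`
-- (Theorems/CardyFlipRussoVoronoiHubFromSmirnovStubCrossRatio.lean, p103893), imported above.

/-- THE KERNEL of every card of this crux: Cardy's formula for annealed Poisson–Voronoi
percolation (Target (i) of route CardyFlipRusso; Benjamini–Schramm 1998, Conj. 1.1 / §10 — open).
Verbatim the consequent of `VoronoiHubFromSmirnov`. -/
theorem stub_annealedVoronoiCardy :
    ∀ (PB PW : MeasureTheory.Measure (Literature.Analysis.FunctionSpaces.PointConfig ℂ)),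
      Literature.Analysis.FunctionSpaces.IsPoissonPointProcess
          (MeasureTheory.volume : MeasureTheory.Measure ℂ) PB →
      Literature.Analysis.FunctionSpaces.IsPoissonPointProcess
          (MeasureTheory.volume : MeasureTheory.Measure ℂ) PW →
      ∀ R : Literature.Probability.RandomPlanarGeometry.ConformalRectangle,
        R.HasCrossingLimit (fun δ ↦ (PB.prod PW).real {c | ∃ x ∈ R.arc 0, ∃ y ∈ R.arc 2,
          JoinedIn (closure R.carrier ∩ {z | Metric.infDist (z / (δ : ℂ)) (c.1 : Set ℂ) ≤
            Metric.infDist (z / (δ : ℂ)) (c.2 : Set ℂ)}) x y})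
          Literature.Probability.RandomPlanarGeometry.cardyFunction := by
  sorry

/-- The landed first lemmas are available under their registered names (import check). -/
example : True := by
  have _h₁ := @stub_delaunayEdgeMoebius
  have _h₂ := @stub_hypDensityInvariant
  have _h₃ := @stub_spinSelection
  have _h₄ := @stub_crossRatioOfAutInvariant
  trivial

/-- Composition: the crux `VoronoiHubFromSmirnov` from the stubs (only the kernel is used; the
antecedent — Smirnov's theorem, proved in tree — is discarded). -/
theorem VoronoiHubFromSmirnov_of :
    Summit.CriticalPhenomena.CardyFormulaZ2.Theses.CardyFlipRusso.VoronoiHubFromSmirnov := by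
  unfold Summit.CriticalPhenomena.CardyFormulaZ2.Theses.CardyFlipRusso.VoronoiHubFromSmirnov
  intro _hSmirnov
  exact stub_annealedVoronoiCardy

end Summit.CriticalPhenomena.CardyFormulaZ2.Cruxes.VoronoiHubFromSmirnov.SketchLine
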